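import Literature.AlgebraicGeometry.Modules.CechEndCochain
import HarnessLib

/-!
# The Čech differential of an `𝓔nd(E)`-cochain in matrix form (degrees `1 → 2` and `2 → 3`)

Continuation of `Modules/CechEndCochain.lean`. For a framing `𝔣 = (U_a, I_a, e_a)` of an
`𝒪_X`-module `E` with transition matrices `T_{ab}`, the morphism `𝔣.toEnd n X : E ⟶ Čⁿ(𝓤, E)` of a
matrix `n`-cochain `X` composed with the Čech differential `d : Čⁿ → Čⁿ⁺¹`
(`Modules/CechResolution.lean`, `(ds)_β = Σ_k (-1)^k s_{β ∘ δ_k}|`) is again of the form `toEnd`, for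
the **twisted matrix differential**

* degree `1`: `(D₁X)_{abd} = T_{ab} X_{bd} - X_{ad} + X_{ab} T_{bd}` (`Framing.D₁`, `toEnd_comp_d_one`),
* degree `2`: `(D₂X)_{abdf} = T_{ab} X_{bdf} - X_{adf} + X_{abf} - X_{abd} T_{df}` (`Framing.D₂`,
  `toEnd_comp_d_two`)

— the first / last face of a simplex changes the first / last vertex, i.e. the frame in which the
matrix is read, which costs a transition matrix (`op_eq_op_of_frame`, `op_eq_op_of_target`). In
particular a matrix `2`-cochain with `D₂X = 0` gives a Čech `2`-COCYCLE `E ⟶ Č²(𝓤, E)`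
(`toEnd_comp_d_two_eq_zero`), and `toEnd 2 (D₁Y)` is a COBOUNDARY (`toEnd_D₁_eq_comp_d`). This is
the matrix calculus of Hartshorne, *Deformation Theory*, proof of Thm. 7.1 (the obstruction cocycle
and its change under a change of lifts). Everything is proved; no named facts.

## References

* R. Hartshorne, *Algebraic Geometry*, GTM 52 (1977), III.4. [Hartshorne1977]
* R. Hartshorne, *Deformation Theory*, GTM 257 (2010), §7, proof of Thm. 7.1. [Hartshorne2010]
-/

noncomputable section

open CategoryTheory AlgebraicGeometry Opposite TopologicalSpace Limits

namespace Literature.AlgebraicGeometry.Modules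

open Literature.AlgebraicGeometry.Motives

universe u

variable {X : Scheme.{u}} {E : X.Modules} {ι : Type u}

namespace Framing

variable (𝔣 : Framing E ι)

/-! ### Bookkeeping -/

/-- Restriction of a section does not depend on the name of the inclusion. [folklore] -/
lemma presheaf_map_congr {W V : X.Opens} (f g : W ⟶ V) (s : Γ(E, V)) :
    E.presheaf.map f.op s = E.presheaf.map g.op s := by
  rw [Subsingleton.elim f g]

/-- Restricting the component of `toEnd n X` on a simplex `α` from `V ∩ U_α` to a smaller open `W'`:
it becomes `op_{α₀ αₙ}(X_α|_{W'})` applied to `s|_{W'}`. [folklore] -/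
lemma res_toEnd_app {n : ℕ} (c : 𝔣.Cochain n) (V : X.Opens) (s : Γ(E, V)) (α : Fin (n + 1) → ι)
    {W' : X.Opens} (l : W' ≤ V ⊓ face 𝔣.U α) :
    E.presheaf.map (homOfLE l).op (((𝔣.toEnd n c).app V s : Cech.Sections 𝔣.U n E V) α) =
      appLE (𝔣.op (α 0) (α (Fin.last n)) W' (l.trans (𝔣.inf_face_le V α 0))
        (l.trans (𝔣.inf_face_le V α (Fin.last n))) (c.mat α W' fun k => l.trans (𝔣.inf_face_le V α k)))
        (𝟙 W') (E.presheaf.map (homOfLE (l.trans inf_le_left)).op s) := by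
  rw [toEnd_app, locOp, res_appLE_op, c.map_mat, presheaf_map_map]
  rfl

/-- `appLE (φ - ψ) = appLE φ - appLE ψ`. [folklore] -/
lemma appLE_sub' {V W : X.Opens} (φ ψ : E.over V ⟶ E.over V) (k : W ⟶ V) (s : Γ(E, W)) :
    appLE (φ - ψ) k s = appLE φ k s - appLE ψ k s :=
  map_sub (appLEHom k s) φ ψ

/-! ### Faces of a matrix cochain, with their shapes made explicit -/

namespace Cochain

variable {𝔣}

/-- The matrix of a `1`-cochain on the face `(β₁, β₂)` of a triangle `β`. [folklore] -/
def tri0 (c : 𝔣.Cochain 1) (β : Fin 3 → ι) (V : X.Opens) (hV : ∀ k, V ≤ 𝔣.U (β k)) :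
    Matrix (𝔣.I (β 1)) (𝔣.I (β (Fin.last 2))) Γ(X, V) :=
  c.mat (β ∘ Fin.succAbove 0) V fun _ => hV _

/-- The matrix of a `1`-cochain on the face `(β₀, β₂)` of a triangle `β`. [folklore] -/
def tri1 (c : 𝔣.Cochain 1) (β : Fin 3 → ι) (V : X.Opens) (hV : ∀ k, V ≤ 𝔣.U (β k)) :
    Matrix (𝔣.I (β 0)) (𝔣.I (β (Fin.last 2))) Γ(X, V) :=
  c.mat (β ∘ Fin.succAbove 1) V fun _ => hV _

/-- The matrix of a `1`-cochain on the face `(β₀, β₁)` of a triangle `β`. [folklore] -/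
def tri2 (c : 𝔣.Cochain 1) (β : Fin 3 → ι) (V : X.Opens) (hV : ∀ k, V ≤ 𝔣.U (β k)) :
    Matrix (𝔣.I (β 0)) (𝔣.I (β 1)) Γ(X, V) :=
  c.mat (β ∘ Fin.succAbove 2) V fun _ => hV _

/-- The face `(β₁, β₂)` matrix is compatible with restriction. [folklore] -/
lemma tri0_map (c : 𝔣.Cochain 1) (β : Fin 3 → ι) {V V' : X.Opens} (hV : ∀ k, V ≤ 𝔣.U (β k))
    (h : V' ≤ V) : (c.tri0 β V hV).map (secRes X h) = c.tri0 β V' fun k => h.trans (hV k) :=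
  c.map_mat _ _ h

/-- The face `(β₀, β₂)` matrix is compatible with restriction. [folklore] -/
lemma tri1_map (c : 𝔣.Cochain 1) (β : Fin 3 → ι) {V V' : X.Opens} (hV : ∀ k, V ≤ 𝔣.U (β k))
    (h : V' ≤ V) : (c.tri1 β V hV).map (secRes X h) = c.tri1 β V' fun k => h.trans (hV k) :=
  c.map_mat _ _ h

/-- The face `(β₀, β₁)` matrix is compatible with restriction. [folklore] -/
lemma tri2_map (c : 𝔣.Cochain 1) (β : Fin 3 → ι) {V V' : X.Opens} (hV : ∀ k, V ≤ 𝔣.U (β k))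
    (h : V' ≤ V) : (c.tri2 β V hV).map (secRes X h) = c.tri2 β V' fun k => h.trans (hV k) :=
  c.map_mat _ _ h

/-- The matrix of a `2`-cochain on the face `(β₁, β₂, β₃)` of a tetrahedron `β`. [folklore] -/
def tet0 (c : 𝔣.Cochain 2) (β : Fin 4 → ι) (V : X.Opens) (hV : ∀ k, V ≤ 𝔣.U (β k)) :
    Matrix (𝔣.I (β 1)) (𝔣.I (β (Fin.last 3))) Γ(X, V) :=
  c.mat (β ∘ Fin.succAbove 0) V fun _ => hV _

/-- The matrix of a `2`-cochain on the face `(β₀, β₂, β₃)`. [folklore] -/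
def tet1 (c : 𝔣.Cochain 2) (β : Fin 4 → ι) (V : X.Opens) (hV : ∀ k, V ≤ 𝔣.U (β k)) :
    Matrix (𝔣.I (β 0)) (𝔣.I (β (Fin.last 3))) Γ(X, V) :=
  c.mat (β ∘ Fin.succAbove 1) V fun _ => hV _

/-- The matrix of a `2`-cochain on the face `(β₀, β₁, β₃)`. [folklore] -/
def tet2 (c : 𝔣.Cochain 2) (β : Fin 4 → ι) (V : X.Opens) (hV : ∀ k, V ≤ 𝔣.U (β k)) :
    Matrix (𝔣.I (β 0)) (𝔣.I (β (Fin.last 3))) Γ(X, V) :=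
  c.mat (β ∘ Fin.succAbove 2) V fun _ => hV _

/-- The matrix of a `2`-cochain on the face `(β₀, β₁, β₂)`. [folklore] -/
def tet3 (c : 𝔣.Cochain 2) (β : Fin 4 → ι) (V : X.Opens) (hV : ∀ k, V ≤ 𝔣.U (β k)) :
    Matrix (𝔣.I (β 0)) (𝔣.I (β 2)) Γ(X, V) :=
  c.mat (β ∘ Fin.succAbove 3) V fun _ => hV _

/-- The face `(β₁, β₂, β₃)` matrix is compatible with restriction. [folklore] -/
lemma tet0_map (c : 𝔣.Cochain 2) (β : Fin 4 → ι) {V V' : X.Opens} (hV : ∀ k, V ≤ 𝔣.U (β k))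
    (h : V' ≤ V) : (c.tet0 β V hV).map (secRes X h) = c.tet0 β V' fun k => h.trans (hV k) :=
  c.map_mat _ _ h

/-- The face `(β₀, β₂, β₃)` matrix is compatible with restriction. [folklore] -/
lemma tet1_map (c : 𝔣.Cochain 2) (β : Fin 4 → ι) {V V' : X.Opens} (hV : ∀ k, V ≤ 𝔣.U (β k))
    (h : V' ≤ V) : (c.tet1 β V hV).map (secRes X h) = c.tet1 β V' fun k => h.trans (hV k) :=
  c.map_mat _ _ h

/-- The face `(β₀, β₁, β₃)` matrix is compatible with restriction. [folklore] -/
lemma tet2_map (c : 𝔣.Cochain 2) (β : Fin 4 → ι) {V V' : X.Opens} (hV : ∀ k, V ≤ 𝔣.U (β k))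
    (h : V' ≤ V) : (c.tet2 β V hV).map (secRes X h) = c.tet2 β V' fun k => h.trans (hV k) :=
  c.map_mat _ _ h

/-- The face `(β₀, β₁, β₂)` matrix is compatible with restriction. [folklore] -/
lemma tet3_map (c : 𝔣.Cochain 2) (β : Fin 4 → ι) {V V' : X.Opens} (hV : ∀ k, V ≤ 𝔣.U (β k))
    (h : V' ≤ V) : (c.tet3 β V hV).map (secRes X h) = c.tet3 β V' fun k => h.trans (hV k) :=
  c.map_mat _ _ h

end Cochain

/-! ### Degree `1 → 2` -/

/-- **The twisted differential of a matrix `1`-cochain**: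
`(D₁X)_{abd} = T_{ab} X_{bd} - X_{ad} + X_{ab} T_{bd}`. [cite: Hartshorne2010, §7 (proof of Thm. 7.1)] -/
def D₁ (c : 𝔣.Cochain 1) : 𝔣.Cochain 2 where
  mat β V hV :=
    𝔣.T (β 0) (β 1) V (hV 0) (hV 1) * c.tri0 β V hV - c.tri1 β V hV +
      c.tri2 β V hV * 𝔣.T (β 1) (β (Fin.last 2)) V (hV 1) (hV (Fin.last 2))
  map_mat β V V' hV h := by
    rw [Matrix.map_add (secRes X h) (map_add _), Matrix.map_sub (secRes X h) (map_sub _), Matrix.map_mul,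
      Matrix.map_mul, T_map, T_map, c.tri0_map, c.tri1_map, c.tri2_map]

/-- Matrices of `D₁`. [folklore] -/
lemma D₁_mat (c : 𝔣.Cochain 1) (β : Fin 3 → ι) (V : X.Opens) (hV : ∀ k, V ≤ 𝔣.U (β k)) :
    (𝔣.D₁ c).mat β V hV =
      𝔣.T (β 0) (β 1) V (hV 0) (hV 1) * c.tri0 β V hV - c.tri1 β V hV +
        c.tri2 β V hV * 𝔣.T (β 1) (β (Fin.last 2)) V (hV 1) (hV (Fin.last 2)) :=
  rfl

/-- **The Čech differential of `toEnd 1 X` is `toEnd 2 (D₁X)`.**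
[cite: Hartshorne2010, §7 (proof of Thm. 7.1)] -/
theorem toEnd_comp_d_one (c : 𝔣.Cochain 1) : 𝔣.toEnd 1 c ≫ Cech.d 𝔣.U E 1 = 𝔣.toEnd 2 (𝔣.D₁ c) := by
  refine Cech.hom_ext_to fun V s β => ?_
  rw [Scheme.Modules.Hom.comp_app, CategoryTheory.comp_apply, Cech.d_app_apply, Fin.sum_univ_three]
  simp only [Fin.val_zero, Fin.val_one, Fin.val_two, pow_zero, pow_one, one_smul, neg_one_zsmul,
    neg_one_sq]
  -- restrict the three components to `W' = V ∩ U_β`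
  rw [𝔣.res_toEnd_app c V s (β ∘ Fin.succAbove 0), 𝔣.res_toEnd_app c V s (β ∘ Fin.succAbove 1),
    𝔣.res_toEnd_app c V s (β ∘ Fin.succAbove 2)]
  -- read everything in the frame `e_{β 0}` with source frame `e_{β 2}`
  set W' := V ⊓ face 𝔣.U β
  have hW : ∀ k, W' ≤ 𝔣.U (β k) := 𝔣.inf_face_le V β
  set t := E.presheaf.map (homOfLE (inf_le_left : W' ≤ V)).op s with ht
  change appLE (𝔣.op (β 1) (β (Fin.last 2)) W' (hW 1) (hW (Fin.last 2)) (c.tri0 β W' hW)) (𝟙 W') (E.presheaf.map _ s) +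
      -appLE (𝔣.op (β 0) (β (Fin.last 2)) W' (hW 0) (hW (Fin.last 2)) (c.tri1 β W' hW)) (𝟙 W') (E.presheaf.map _ s) +
      appLE (𝔣.op (β 0) (β 1) W' (hW 0) (hW 1) (c.tri2 β W' hW)) (𝟙 W') (E.presheaf.map _ s) =
    appLE (𝔣.op (β 0) (β (Fin.last 2)) W' (hW 0) (hW (Fin.last 2)) ((𝔣.D₁ c).mat β W' hW)) (𝟙 W') (E.presheaf.map _ s)
  rw [presheaf_map_congr _ (homOfLE (inf_le_left : W' ≤ V)) s,
    presheaf_map_congr _ (homOfLE (inf_le_left : W' ≤ V)) s,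
    presheaf_map_congr _ (homOfLE (inf_le_left : W' ≤ V)) s,
    presheaf_map_congr _ (homOfLE (inf_le_left : W' ≤ V)) s, ← ht,
    𝔣.op_eq_op_of_frame (β 0) (β 1) (β (Fin.last 2)) W' (hW 0) (hW 1) (hW (Fin.last 2)),
    𝔣.op_eq_op_of_target (β 0) (β 1) (β (Fin.last 2)) W' (hW 0) (hW 1) (hW (Fin.last 2)), D₁_mat, op_add, op_sub, appLE_add,
    appLE_sub']
  abel

/-- `toEnd 2 (D₁ Y)` is a Čech coboundary. [folklore] -/
theorem toEnd_D₁_eq_comp_d (c : 𝔣.Cochain 1) : 𝔣.toEnd 2 (𝔣.D₁ c) = 𝔣.toEnd 1 c ≫ Cech.d 𝔣.U E 1 :=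
  (𝔣.toEnd_comp_d_one c).symm

/-! ### Degree `2 → 3` -/

/-- **The twisted differential of a matrix `2`-cochain**:
`(D₂X)_{abdf} = T_{ab} X_{bdf} - X_{adf} + X_{abf} - X_{abd} T_{df}`.
[cite: Hartshorne2010, §7 (proof of Thm. 7.1)] -/
def D₂ (c : 𝔣.Cochain 2) : 𝔣.Cochain 3 where
  mat β V hV :=
    𝔣.T (β 0) (β 1) V (hV 0) (hV 1) * c.tet0 β V hV - c.tet1 β V hV + c.tet2 β V hV -
      c.tet3 β V hV * 𝔣.T (β 2) (β (Fin.last 3)) V (hV 2) (hV (Fin.last 3))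
  map_mat β V V' hV h := by
    rw [Matrix.map_sub (secRes X h) (map_sub _), Matrix.map_add (secRes X h) (map_add _),
      Matrix.map_sub (secRes X h) (map_sub _), Matrix.map_mul, Matrix.map_mul, T_map, T_map, c.tet0_map,
      c.tet1_map, c.tet2_map, c.tet3_map]

/-- Matrices of `D₂`. [folklore] -/
lemma D₂_mat (c : 𝔣.Cochain 2) (β : Fin 4 → ι) (V : X.Opens) (hV : ∀ k, V ≤ 𝔣.U (β k)) :
    (𝔣.D₂ c).mat β V hV =
      𝔣.T (β 0) (β 1) V (hV 0) (hV 1) * c.tet0 β V hV - c.tet1 β V hV + c.tet2 β V hV -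
        c.tet3 β V hV * 𝔣.T (β 2) (β (Fin.last 3)) V (hV 2) (hV (Fin.last 3)) :=
  rfl

/-- **The Čech differential of `toEnd 2 X` is `toEnd 3 (D₂X)`.**
[cite: Hartshorne2010, §7 (proof of Thm. 7.1)] -/
theorem toEnd_comp_d_two (c : 𝔣.Cochain 2) : 𝔣.toEnd 2 c ≫ Cech.d 𝔣.U E 2 = 𝔣.toEnd 3 (𝔣.D₂ c) := by
  refine Cech.hom_ext_to fun V s β => ?_
  rw [Scheme.Modules.Hom.comp_app, CategoryTheory.comp_apply, Cech.d_app_apply, Fin.sum_univ_four]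
  simp only [Fin.val_zero, Fin.val_one, Fin.val_two, pow_zero, pow_one, one_smul, neg_one_zsmul,
    neg_one_sq]
  have hv3 : ((3 : Fin 4) : ℕ) = 3 := rfl
  rw [hv3, show ((-1 : ℤ) ^ 3) = -1 by norm_num, neg_one_zsmul]
  rw [𝔣.res_toEnd_app c V s (β ∘ Fin.succAbove 0), 𝔣.res_toEnd_app c V s (β ∘ Fin.succAbove 1),
    𝔣.res_toEnd_app c V s (β ∘ Fin.succAbove 2), 𝔣.res_toEnd_app c V s (β ∘ Fin.succAbove 3)]
  set W' := V ⊓ face 𝔣.U β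
  have hW : ∀ k, W' ≤ 𝔣.U (β k) := 𝔣.inf_face_le V β
  set t := E.presheaf.map (homOfLE (inf_le_left : W' ≤ V)).op s with ht
  change appLE (𝔣.op (β 1) (β (Fin.last 3)) W' (hW 1) (hW (Fin.last 3)) (c.tet0 β W' hW)) (𝟙 W') (E.presheaf.map _ s) +
      -appLE (𝔣.op (β 0) (β (Fin.last 3)) W' (hW 0) (hW (Fin.last 3)) (c.tet1 β W' hW)) (𝟙 W') (E.presheaf.map _ s) +
      appLE (𝔣.op (β 0) (β (Fin.last 3)) W' (hW 0) (hW (Fin.last 3)) (c.tet2 β W' hW)) (𝟙 W') (E.presheaf.map _ s) +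
      -appLE (𝔣.op (β 0) (β 2) W' (hW 0) (hW 2) (c.tet3 β W' hW)) (𝟙 W') (E.presheaf.map _ s) =
    appLE (𝔣.op (β 0) (β (Fin.last 3)) W' (hW 0) (hW (Fin.last 3)) ((𝔣.D₂ c).mat β W' hW)) (𝟙 W') (E.presheaf.map _ s)
  rw [presheaf_map_congr _ (homOfLE (inf_le_left : W' ≤ V)) s,
    presheaf_map_congr _ (homOfLE (inf_le_left : W' ≤ V)) s,
    presheaf_map_congr _ (homOfLE (inf_le_left : W' ≤ V)) s,
    presheaf_map_congr _ (homOfLE (inf_le_left : W' ≤ V)) s,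
    presheaf_map_congr _ (homOfLE (inf_le_left : W' ≤ V)) s, ← ht,
    𝔣.op_eq_op_of_frame (β 0) (β 1) (β (Fin.last 3)) W' (hW 0) (hW 1) (hW (Fin.last 3)),
    𝔣.op_eq_op_of_target (β 0) (β 2) (β (Fin.last 3)) W' (hW 0) (hW 2) (hW (Fin.last 3)), D₂_mat, op_sub, op_add, op_sub,
    appLE_sub', appLE_add, appLE_sub']
  abel

/-- **A matrix `2`-cochain with `D₂X = 0` defines a Čech `2`-cocycle.**
[cite: Hartshorne2010, §7 (proof of Thm. 7.1)] -/
theorem toEnd_comp_d_two_eq_zero (c : 𝔣.Cochain 2) (hc : 𝔣.D₂ c = 0) :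
    𝔣.toEnd 2 c ≫ Cech.d 𝔣.U E 2 = 0 := by
  rw [toEnd_comp_d_two, hc]
  exact Cech.hom_ext_to fun V s α => by
    rw [toEnd_app, locOp, Cochain.zero_mat, op_zero, appLE_zero, ← Cech.evalAt_apply V s α, map_zero]

/-- The same, as a cocycle of the Čech COMPLEX (`(complex).d 2 3 = Cech.d 2`). [folklore] -/
theorem toEnd_comp_complex_d_eq_zero (c : 𝔣.Cochain 2) (hc : 𝔣.D₂ c = 0) :
    𝔣.toEnd 2 c ≫ (Cech.complex 𝔣.U E).d 2 3 = 0 := by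
  rw [Cech.complex_d]
  exact 𝔣.toEnd_comp_d_two_eq_zero c hc

end Framing

end Literature.AlgebraicGeometry.Modules

end
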